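import Literature.AlgebraicGeometry.HodgeTheory.HodgeClassOfMorphismProofs
import Literature.AlgebraicGeometry.HodgeTheory.LefschetzOneOneHolds
import Literature.AlgebraicGeometry.HodgeTheory.SupportedHodgeClassDescent
import Literature.AlgebraicGeometry.HodgeTheory.GysinKernelProofs
import HarnessLib

/-!
# Pushing a correspondence forward along its first factor; weight-one curve–surface
# correspondences are algebraic

Family `hodge`, layer `Literature/AlgebraicGeometry/HodgeTheory`. Two classical steps of
Grothendieck's argument that the generalised Hodge conjecture in level one is EQUIVALENT to the
algebraicity of the level-one curve correspondences into `H³` (Topology 8 (1969), p. 301; Abdulali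
in Kerr–Pearlstein 2016, Ch. 11, Prop. 3.2), read on the tree's carriers (`corrAction`,
`complexGysin`, `algebraicClasses`):

* `corrAction_complexGysin_whiskerRight` — **the action of a pushed-forward correspondence**: for
  `g : S ⟶ Y` and `γ' ∈ H^{2e'}((S ⊗ X)(ℂ))`, `((g × 𝟙)_* γ')_* = g_* ∘ γ'_*` (projection formula
  `f_*(f^* x ∪ y) = x ∪ f_* y` and functoriality `(f ≫ h)_* = h_* ∘ f_*` of the Gysin morphisms,
  Fulton App. B (2), (5), (6), with `(g × 𝟙) ≫ pr_X = pr_X`, `(g × 𝟙) ≫ pr_Y = pr_S ≫ g`);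
* `complexGysin_mem_algebraicClasses_of_mem_algebraicClasses` — Gysin morphisms map algebraic
  classes to algebraic classes (Voisin II Prop. 9.21 (ii), "`cl(i_* Z) = i_* cl(Z)`", via the support
  property of Gysin maps, a theorem of the tree);
* `exists_algebraicClass_corrAction_eq_of_weightOne` — **a rational type-`(0,0)` map
  `H¹(C(ℂ)) → H¹(S(ℂ))` between smooth projective varieties is the action of an ALGEBRAIC
  codimension-1 class on `S ⊗ C`**: it is `t⁻¹ • γ_*` for a rational `(1,1)`-class `γ` (Voisin I
  Lemma 11.41, the tree's `exists_rational_hodgeClass_corrAction_eq_smul`), algebraic by the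
  Lefschetz theorem on `(1,1)`-classes (the tree's `lefschetzOneOne_rational_holds`);
* `exists_algebraicClass_corrAction_eq_complexGysin_comp` — hence `g_* ∘ ψ`, for
  `g : S ⟶ Y` a morphism from a smooth projective surface to a smooth projective threefold and
  `ψ : H¹(C(ℂ)) → H¹(S(ℂ))` rational of type `(0,0)`, is the action of an algebraic codimension-2
  class on `Y ⊗ C`; and `exists_algebraicClass_corrAction_eq_sum_complexGysin_comp` for finite sums.

Everything is proved; no definition, no named fact.

## References

* [GrothendieckTopology1969] A. Grothendieck, Topology 8 (1969), p. 301.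
* [KerrPearlstein2016] Kerr–Pearlstein (eds.), Recent Advances in Hodge Theory, Ch. 11 (Abdulali)
  Prop. 3.2 p. 291.
* [FultonYoungTableaux1997] W. Fulton, Young Tableaux, App. B §B.1 (1)–(6).
* [VoisinHodgeI2002] C. Voisin, Hodge Theory and Complex Algebraic Geometry I, Thm. 11.30 and
  §11.3.3 Lemma 11.41.
* [VoisinHodgeII2003] C. Voisin, Hodge Theory and Complex Algebraic Geometry II, §9.2.4
  Prop. 9.21 (ii).
-/

noncomputable section

open CategoryTheory AlgebraicGeometry MonoidalCategory CartesianMonoidalCategory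
open Literature.AlgebraicTopology.SingularHomology

namespace Literature.AlgebraicGeometry.HodgeTheory

section HodgeTheory

variable (μ : OrientationFamily)

/-! ### The action of a pushed-forward correspondence -/

/-- **`((g × 𝟙_X)_* γ')_* = g_* ∘ γ'_*`.** For `g : S ⟶ Y` between smooth projective varieties of
dimensions `l`, `m`, a smooth projective `X` of dimension `n`, and `γ' ∈ H^{2e'}((S ⊗ X)(ℂ); ℂ)`,
the action of the pushed-forward class `(g ▷ X)_* γ' ∈ H^{2e}((Y ⊗ X)(ℂ); ℂ)` (`e' + m = e + l`)
on `c ∈ Hᵃ(X(ℂ))` is `g_*(γ'_* c)`: by the projection formula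
`pr_X^* c ∪ (g ▷ X)_* γ' = (g ▷ X)_*((g ▷ X)^* pr_X^* c ∪ γ') = (g ▷ X)_*(pr_X^* c ∪ γ')`, and
`pr_{Y*} ∘ (g ▷ X)_* = ((g ▷ X) ≫ pr_Y)_* = (pr_S ≫ g)_* = g_* ∘ pr_{S*}`.
[cite: FultonYoungTableaux1997, Appendix B §B.1 (2), (5) and (6)] -/
theorem corrAction_complexGysin_whiskerRight {l m n : ℕ} {S Y X : Motives.SchemeOver ℂ}
    (hS : Motives.IsSmoothProjective l S) (hY : Motives.IsSmoothProjective m Y)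
    (hX : Motives.IsSmoothProjective n X) (g : S ⟶ Y) {e e' a b b' : ℕ}
    (hab' : a + 2 * e' = b' + 2 * n) (hab : a + 2 * e = b + 2 * n)
    (hee' : 2 * e' + 2 * (m + n) = 2 * e + 2 * (l + n)) (hbb' : b' + 2 * m = b + 2 * l)
    (γ' : complexBetti (S ⊗ X) (2 * e')) (c : complexBetti X a) :
    corrAction μ hY hX hab
        (complexGysin μ (Motives.IsSmoothProjective.tensor_holds hS hX)
          (Motives.IsSmoothProjective.tensor_holds hY hX) (g ▷ X) hee' γ') c =
      complexGysin μ hS hY g hbb' (corrAction μ hS hX hab' γ' c) := by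
  have hμ : μ.HasPoincareDuality := μ.hasPoincareDuality
  have hSX := Motives.IsSmoothProjective.tensor_holds hS hX
  have hYX := Motives.IsSmoothProjective.tensor_holds hY hX
  rw [corrAction_apply, corrAction_apply]
  -- projection formula for `g ▷ X`
  have hproj := complexGysin_cup hμ hSX hYX (g ▷ X) (rfl : a + 2 * e' = a + 2 * e')
    (show (a + 2 * e') + 2 * (m + n) = (a + 2 * e) + 2 * (l + n) by omega) hee'
    (rfl : a + 2 * e = a + 2 * e) (complexBetti.map (snd Y X) a c) γ'
  -- `(g ▷ X)^* pr_X^* c = pr_X^* c`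
  have hpull : complexBetti.map (g ▷ X) a (complexBetti.map (snd Y X) a c) =
      complexBetti.map (snd S X) a c := by
    change (complexBetti.map (snd Y X) a ≫ complexBetti.map (g ▷ X) a) c = _
    rw [← complexBetti.map_comp, whiskerRight_snd]
  rw [hpull] at hproj
  rw [← hproj, ← LinearMap.comp_apply,
    ← complexGysin_comp hμ hSX hYX hY (g ▷ X) (fst Y X)
      (show (a + 2 * e') + 2 * (m + n) = (a + 2 * e) + 2 * (l + n) by omega) (corrAction_degree m hab)]
  -- `(g ▷ X) ≫ pr_Y = pr_S ≫ g`
  have hfst : (g ▷ X) ≫ fst Y X = fst S X ≫ g := whiskerRight_fst g X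
  simp only [hfst]
  rw [complexGysin_comp hμ hSX hS hY (fst S X) g (corrAction_degree l hab') hbb', LinearMap.comp_apply]

/-! ### Gysin morphisms preserve algebraic classes -/

/-- **`f_* (N^{e'} H^{2e'}(S(ℂ))) ⊆ Nᵉ H^{2e}(Y(ℂ))`, `e' + m = e + l`** (Voisin II Prop. 9.21 (ii):
"`cl(i_* Z) = i_* cl(Z)`" on the coniveau carrier): a class dying off a closed `T ⊆ S` of
codimension `≥ e'` is pushed to a class dying off the closed `f(T)`, of codimension `≥ e`
(`complexGysin_mem_supportedClasses` with the support property of Gysin maps,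
`gysinMap_restrictCompl_eq_zero_of_field ℂ`, a theorem of the tree).
[cite: VoisinHodgeII2003, §9.2.4 Prop. 9.21 (ii)] -/
theorem complexGysin_mem_algebraicClasses_of_mem_algebraicClasses {l m : ℕ}
    {S Y : Motives.SchemeOver ℂ} (hS : Motives.IsSmoothProjective l S)
    (hY : Motives.IsSmoothProjective m Y) (f : S ⟶ Y) {e' e : ℕ}
    (hee' : 2 * e' + 2 * m = 2 * e + 2 * l) {γ' : complexBetti S (2 * e')}
    (h : γ' ∈ algebraicClasses S e') :
    complexGysin μ hS hY f hee' γ' ∈ algebraicClasses Y e :=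
  complexGysin_mem_supportedClasses (gysinMap_restrictCompl_eq_zero_of_field ℂ) μ
    μ.hasPoincareDuality hS hY f hee' (r := e') (s := e) (by omega) h

/-! ### Weight-one curve–surface correspondences are algebraic (Lefschetz `(1,1)`) -/

/-- **A rational type-`(0,0)` map `ψ : H¹(C(ℂ)) → H¹(S(ℂ))` between smooth projective varieties
(`C` a curve, `S` of dimension `l`) is the action of an ALGEBRAIC codimension-1 class on `S ⊗ C`.**
By Voisin I Lemma 11.41 on the tree's carriers (`exists_rational_hodgeClass_corrAction_eq_smul`,
unconditional) `ψ = t⁻¹ • γ_*` for a rational class `γ ∈ H²((S ⊗ C)(ℂ); ℂ)` of Hodge type `(1,1)`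
and `t ≠ 0`; by the Lefschetz theorem on `(1,1)`-classes (the tree's `lefschetzOneOne_rational_holds`)
`γ` is algebraic, i.e. lies in `algebraicClasses (S ⊗ C) 1`. [cite: VoisinHodgeI2002, Thm. 11.30 and §11.3.3 Lemma 11.41] -/
theorem exists_algebraicClass_corrAction_eq_of_weightOne {l : ℕ} {S C : Motives.SchemeOver ℂ}
    (hS : Motives.IsSmoothProjective l S) (hC : Motives.IsSmoothProjective 1 C) (A : HodgeModel l S)
    (B : HodgeModel 1 C) (ψ : complexBetti C 1 →ₗ[ℂ] complexBetti S 1)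
    (hψ : ∀ c, IsRationalClass c → IsRationalClass (ψ c))
    (hψH : ∀ (p q : ℕ), p + q = 1 → ∀ c, B.pullback 1 c ∈ B.hodgePQ 1 p q →
      A.pullback 1 (ψ c) ∈ A.hodgePQ 1 (p + 0) (q + 0)) :
    ∃ γ ∈ algebraicClasses (S ⊗ C) 1,
      corrAction μ hS hC (show 1 + 2 * 1 = 1 + 2 * 1 from rfl) γ = ψ := by
  obtain ⟨γ, hγ, hγH, t, ht, heq⟩ :=
    exists_rational_hodgeClass_corrAction_eq_smul hS hC A B (show 1 + 2 * 1 = 1 + 2 * 1 from rfl)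
      (show 1 + 0 = 1 from rfl) ψ hψ hψH μ
  have halg : γ ∈ algebraicClasses (S ⊗ C) 1 :=
    lefschetzOneOne_rational_holds (Motives.IsSmoothProjective.tensor_holds hS hC) γ hγ hγH
  refine ⟨t⁻¹ • γ, Submodule.smul_mem _ _ halg, ?_⟩
  rw [map_smul, heq, smul_smul, inv_mul_cancel₀ ht, one_smul]

/-- **`g_* ∘ ψ` is the action of an algebraic codimension-2 class on `Y ⊗ C`**, for `g : S ⟶ Y` a
morphism from a smooth projective surface to a smooth projective threefold, `C` a smooth projective
curve and `ψ : H¹(C(ℂ)) → H¹(S(ℂ))` rational of type `(0,0)`: `ψ = γ'_*` with `γ'` algebraic of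
codimension `1` on `S ⊗ C` (`exists_algebraicClass_corrAction_eq_of_weightOne`), and
`g_* ∘ γ'_* = ((g ▷ C)_* γ')_*` (`corrAction_complexGysin_whiskerRight`) with `(g ▷ C)_* γ'`
algebraic of codimension `2` on `Y ⊗ C`. This is the mechanism of the implication "GHC(3,1) ⟹ the
level-one curve correspondences into `H³` are algebraic". [cite: GrothendieckTopology1969, p. 301]
[cite: KerrPearlstein2016, Ch. 11 (Abdulali) Prop. 3.2 p. 291] -/
theorem exists_algebraicClass_corrAction_eq_complexGysin_comp {S Y C : Motives.SchemeOver ℂ}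
    (hS : Motives.IsSmoothProjective 2 S) (hY : Motives.IsSmoothProjective 3 Y)
    (hC : Motives.IsSmoothProjective 1 C) (g : S ⟶ Y) (A : HodgeModel 2 S) (B : HodgeModel 1 C)
    (ψ : complexBetti C 1 →ₗ[ℂ] complexBetti S 1) (hψ : ∀ c, IsRationalClass c → IsRationalClass (ψ c))
    (hψH : ∀ (p q : ℕ), p + q = 1 → ∀ c, B.pullback 1 c ∈ B.hodgePQ 1 p q →
      A.pullback 1 (ψ c) ∈ A.hodgePQ 1 (p + 0) (q + 0)) :
    ∃ γ ∈ algebraicClasses (Y ⊗ C) 2,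
      corrAction μ hY hC (show 1 + 2 * 2 = 3 + 2 * 1 from rfl) γ =
        complexGysin μ hS hY g (show 1 + 2 * 3 = 3 + 2 * 2 from rfl) ∘ₗ ψ := by
  obtain ⟨γ', hγ', hγ'ψ⟩ := exists_algebraicClass_corrAction_eq_of_weightOne μ hS hC A B ψ hψ hψH
  refine ⟨complexGysin μ (Motives.IsSmoothProjective.tensor_holds hS hC)
      (Motives.IsSmoothProjective.tensor_holds hY hC) (g ▷ C)
      (show 2 * 1 + 2 * (3 + 1) = 2 * 2 + 2 * (2 + 1) from rfl) γ',
    complexGysin_mem_algebraicClasses_of_mem_algebraicClasses μ _ _ (g ▷ C) _ hγ', ?_⟩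
  ext c
  rw [LinearMap.comp_apply, ← hγ'ψ]
  exact corrAction_complexGysin_whiskerRight μ hS hY hC g (show 1 + 2 * 1 = 1 + 2 * 1 from rfl)
    (show 1 + 2 * 2 = 3 + 2 * 1 from rfl) _ _ γ' c

/-- **Finite sums**: `Σⱼ (gⱼ)_* ∘ ψⱼ` is the action of an algebraic codimension-2 class on `Y ⊗ C`
(the action is linear in the class, and algebraic classes form a subspace).
[cite: GrothendieckTopology1969, p. 301] [cite: KerrPearlstein2016, Ch. 11 (Abdulali) Prop. 3.2 p. 291] -/
theorem exists_algebraicClass_corrAction_eq_sum_complexGysin_comp {ι : Type} [Fintype ι]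
    {Y C : Motives.SchemeOver ℂ} (hY : Motives.IsSmoothProjective 3 Y)
    (hC : Motives.IsSmoothProjective 1 C) (B : HodgeModel 1 C) {S : ι → Motives.SchemeOver ℂ}
    (hS : ∀ j, Motives.IsSmoothProjective 2 (S j)) (g : ∀ j, S j ⟶ Y) (A : ∀ j, HodgeModel 2 (S j))
    (ψ : ∀ j, complexBetti C 1 →ₗ[ℂ] complexBetti (S j) 1)
    (hψ : ∀ j c, IsRationalClass c → IsRationalClass (ψ j c))
    (hψH : ∀ j (p q : ℕ), p + q = 1 → ∀ c, B.pullback 1 c ∈ B.hodgePQ 1 p q →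
      (A j).pullback 1 (ψ j c) ∈ (A j).hodgePQ 1 (p + 0) (q + 0)) :
    ∃ γ ∈ algebraicClasses (Y ⊗ C) 2,
      corrAction μ hY hC (show 1 + 2 * 2 = 3 + 2 * 1 from rfl) γ =
        ∑ j, complexGysin μ (hS j) hY (g j) (show 1 + 2 * 3 = 3 + 2 * 2 from rfl) ∘ₗ ψ j := by
  classical
  choose γ hγ hγeq using fun j ↦ exists_algebraicClass_corrAction_eq_complexGysin_comp μ (hS j) hY hC
    (g j) (A j) B (ψ j) (hψ j) (hψH j)
  refine ⟨∑ j, γ j, Submodule.sum_mem _ fun j _ ↦ hγ j, ?_⟩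
  rw [map_sum]
  exact Finset.sum_congr rfl fun j _ ↦ hγeq j

end HodgeTheory

end Literature.AlgebraicGeometry.HodgeTheory

end
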